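import Summits.Ventures.CertifiedManyBodySolver.Observables.RungLeavesCoverageHg1201PatchL
import HarnessLib

/-!
# Ventures/CertifiedManyBodySolver — Observables/RungLeavesCoverageHg1201SlabFromStation.lean

THE «L» AT A HIGHER STATION `U_A = U†` — the BANKING edition for decision-node zones (ii)(c)/(iii) of the Hg-1201 captain's plan
(hubbard-cov-hg1201-plan-1 HG1201-COVERAGE-PLAN v0.2 §3.3 (c), hubbard-obs STATUS 2026-08-28T06:33:50Z: «bank M19b ∩ {U ≥ U†} = unc-2 slab/slice leaf images +
box-1 «slabFromTop» twin of `hg1201M19b_slabFromBottom_of_patchL_cornerObjective` at U_A = U† (left-edge words on [U†, 44/5] + bottom bundle AT U†)»).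
If the corner word at `U = 7/2` lands above the bar, the line banks the `U`-slab `[U†, 44/5]` (`U† ∈ {5, 32/5, …}`) where the words clear it:

* `hg1201M19b_slabFromStation_of_L_cornerObjective` — for a station `U_A ∈ [7/2, 44/5]`: per density `x ∈ [87/100, 183/200]`, a LEFT-EDGE corner-objective family
  `vL x U′` on `U′ ∈ [U_A, 44/5]` (classes at `(−27/50, U′, x)`, objective `−X₀(−27/50, U′)`) and a BOTTOM-AT-`U_A` corner-objective family `vB x s` on
  `s ∈ [−27/50, −13/25]` (classes at `(s, U_A, x)`, objective `−X₀(−27/50, U_A)`), both `−v ≤ 0.5166800` ⇒ the M19b cell statement on the slab: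
  `∀ tp ∈ [−27/50, −43/100], ∀ U ∈ [U_A, 44/5], ∀ n ∈ [167/200, 183/200], ObsStiffnessSeqCeilingAt tp U n (5166800/10⁷)` — the hypothesis shape of hubbard-downfold-unc-2's
  slab / slice leaf images (`Downfold/BoxesHg1201ESliceByValue.lean`, p610329) and of the PEN-draft `HighUSlabCeiling` at `U_A = 5`;
* `hg1201M19b_slabWord_of_L_cornerObjective` — the same per density `n ∈ [87/100, 183/200]` on the patch strip only (`t′ ∈ [−27/50, −13/25]`), explicit word `c ∈ [0.5152137, 0.5166800]`.
Inner-END reads discharged kinematically (hubbard-cov-hg1201-box-2's `orbitMean_neg_oddMomentTT_lam_zero_ge_kinematic_of_gs` on `halfBathtub_m13o25_chordLevel_le`), σ-chord by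
`orbitLower_slot_chord_of_two_endObjectives`, transport by `ObsStiffnessSeqCeilingAt_on_box_of_bottomEdge_and_leftEdge_targetSlot` (U_A := U†, U_max := 44/5), kinematic cover off
the patch by `hg1201M19b_cell_of_cornerPatch` — exactly the `U_A = 7/2` file `…PatchL.lean` with the station freed.

All PROVED; zero solve, no definition, no claim node, no `sorry`. HONEST FRAMING: obligation-shape closer, CONDITIONAL on families no certificate supplies yet; the banked
slab is a SUB-BOX word, not the rung leaf (the leaf needs `U_A = 7/2`); CEILINGS on a downfolded box = CONTROL / CALIBRATION + labelled heuristic (xx1); «content» =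
below `0.98 ×` the kinematic MAJORANT word, no suppression below free fermions claimed; never a presence statement; not a `T_c` or phase sentence.

Cell `pub/hubbard-obs` (LADDER-HUBBARD MO-S2, D-0154 (1)(C) Hg-1201), seat `hubbard-cov-hg1201-box-1` (`prover-hubbard-cov-hg1201-box-1-0`).
References: T. Koma, H. Tasaki, J. Stat. Phys. 76 (1994) 745, §1 [KomaTasaki1994]; D. J. Scalapino, S. R. White, S.-C. Zhang, PRB 47 (1993) 7995, §II [ScalapinoWhiteZhang1993].
-/

noncomputable section

namespace Summit.Ventures.CertifiedManyBodySolver.Observables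

open Real Set NonemptyInterval Filter Topology
open Summit.Ventures.CertifiedManyBodySolver.Downfold
open Summit.Ventures.CertifiedManyBodySolver.Certificates
open Literature.MathematicalPhysics.QuantumLattice Literature.MathematicalPhysics.QuantumLattice.ThermodynamicLimit
open Literature.Probability.LatticeModels
open Matrix HubbardWave0
open scoped BigOperators ComplexOrder

/-- **PATCH-STRIP WORD on the slab `[U_A, 44/5]` from the «L» at the station `U_A`, corner-objective reads only** (density `0 ≤ n ≤ 183/200`; word
`c ∈ [0.5152137, …]`): left-edge family `vL U′` on `U′ ∈ [U_A, 44/5]` for `−X₀(−27/50, U′)` at `(−27/50, U′, n)`, bottom family `vB s` on `s ∈ [−27/50, −13/25]` for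
`−X₀(−27/50, U_A)` at `(s, U_A, n)`, `−v ≤ c` ⇒ `ObsStiffnessSeqCeilingAt t′ U n c` on `[−27/50, −13/25] × [U_A, 44/5]`. [cite: KomaTasaki1994, §1] [cite: ScalapinoWhiteZhang1993, §II] -/
theorem hg1201M19b_slabWord_of_L_cornerObjective {UA : ℝ} (hUA : UA ∈ Set.Icc (7 / 2 : ℝ) (44 / 5)) {n : ℝ} (hn0 : 0 ≤ n) (hn : n ≤ 183 / 200)
    (vL vB : ℝ → ℝ) (c : ℚ) (hkin : (5152137 / 10000000 : ℚ) ≤ c)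
    (hL : ∀ U' ∈ Set.Icc UA (44 / 5),
      ∀ (ω : InfVolFermionState 2) (Ls : ℕ → ℕ) (ψ : ∀ L, Fock (Orb (FermionTorus 2 L))),
      Tendsto Ls atTop atTop →
      (∀ j, IsGroundStateInSector (hubbardTorusTT' (Ls j) 1 (-27 / 50) U') (rectN n (Ls j)) 0 (ψ (Ls j))) →
      (∀ j, star (ψ (Ls j)) ⬝ᵥ ψ (Ls j) = 1) → ω.IsTorusLimitOf ψ Ls →
      vL U' ≤ ((Finset.univ : Finset (DihedralGroup 4)).card : ℝ)⁻¹ * ∑ g ∈ (Finset.univ : Finset (DihedralGroup 4)),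
        (ω.expect (d4ShiftSet g 0 (box 2 7)) (fermionEmbed (PolySite.d4Emb g 0 (box 2 7)) (-oddMomentObsTT (-27 / 50) U' 0))).re)
    (hcL : ∀ U' ∈ Set.Icc UA (44 / 5), -vL U' ≤ ((c : ℚ) : ℝ))
    (hB : ∀ s ∈ Set.Icc (-27 / 50 : ℝ) (-13 / 25),
      ∀ (ω : InfVolFermionState 2) (Ls : ℕ → ℕ) (ψ : ∀ L, Fock (Orb (FermionTorus 2 L))),
      Tendsto Ls atTop atTop →
      (∀ j, IsGroundStateInSector (hubbardTorusTT' (Ls j) 1 s UA) (rectN n (Ls j)) 0 (ψ (Ls j))) →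
      (∀ j, star (ψ (Ls j)) ⬝ᵥ ψ (Ls j) = 1) → ω.IsTorusLimitOf ψ Ls →
      vB s ≤ ((Finset.univ : Finset (DihedralGroup 4)).card : ℝ)⁻¹ * ∑ g ∈ (Finset.univ : Finset (DihedralGroup 4)),
        (ω.expect (d4ShiftSet g 0 (box 2 7)) (fermionEmbed (PolySite.d4Emb g 0 (box 2 7)) (-oddMomentObsTT (-27 / 50) UA 0))).re)
    (hcB : ∀ s ∈ Set.Icc (-27 / 50 : ℝ) (-13 / 25), -vB s ≤ ((c : ℚ) : ℝ)) :
    ∀ tp ∈ Set.Icc (-27 / 50 : ℝ) (-13 / 25), ∀ U ∈ Set.Icc UA (44 / 5), ObsStiffnessSeqCeilingAt tp U n c := by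
  have hn2 : n < 2 := by linarith
  have hUA0 : 0 < UA := by linarith [hUA.1]
  have hKQc : -(-((43731 / 90112 : ℝ) * n / 2 + ((9 / 11 : ℝ) * 0.3123804228 + 2 / 11 * 0.2068368242))) ≤ ((c : ℚ) : ℝ) := by
    rw [neg_neg]
    exact (hg1201_innerKinematicReading_le hn).trans (by exact_mod_cast hkin)
  refine ObsStiffnessSeqCeilingAt_on_box_of_bottomEdge_and_leftEdge_targetSlot (p := -27 / 50) (q := -13 / 25) (UA := UA)
    (Umax := 44 / 5) (n := n) hUA0 hUA.2 (by norm_num) hn0 hn2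
    (fun σ s => (-13 / 25 - σ) / (-13 / 25 - -27 / 50) * vB s +
      (σ - -27 / 50) / (-13 / 25 - -27 / 50) * (-((43731 / 90112 : ℝ) * n / 2 + ((9 / 11 : ℝ) * 0.3123804228 + 2 / 11 * 0.2068368242))))
    (fun σ U' => (-13 / 25 - σ) / (-13 / 25 - -27 / 50) * vL U' +
      (σ - -27 / 50) / (-13 / 25 - -27 / 50) * (-((43731 / 90112 : ℝ) * n / 2 + ((9 / 11 : ℝ) * 0.3123804228 + 2 / 11 * 0.2068368242)))) c
    (fun σ hσ s hs ω Ls ψ hLs hψ h1 hω => ?_) (fun σ hσ s hs => ?_) (fun σ hσ U' hU' ω Ls ψ hLs hψ h1 hω => ?_)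
    (fun σ hσ U' hU' => ?_)
  · have hsI : s ∈ Set.Icc (-27 / 50 : ℝ) (-13 / 25) := ⟨hs.1, hs.2.trans hσ.2⟩
    exact orbitLower_slot_chord_of_two_endObjectives hω.isTranslationInvariant UA (by norm_num) hσ
      (hB s hsI ω Ls ψ hLs hψ h1 hω)
      (orbitMean_neg_oddMomentTT_lam_zero_ge_kinematic_of_gs (-13 / 25) UA s UA halfBathtub_m13o25_chordLevel_le
        hn0 hn2 ω Ls ψ hLs hψ h1 hω)
  · obtain ⟨ha, hb, hab⟩ := hg1201_patch_slotWeights hσ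
    exact neg_convexComb_le_of_neg_le ha hb hab (hcB s ⟨hs.1, hs.2.trans hσ.2⟩) hKQc
  · exact orbitLower_slot_chord_of_two_endObjectives hω.isTranslationInvariant U' (by norm_num) hσ
      (hL U' hU' ω Ls ψ hLs hψ h1 hω)
      (orbitMean_neg_oddMomentTT_lam_zero_ge_kinematic_of_gs (-13 / 25) U' (-27 / 50) U' halfBathtub_m13o25_chordLevel_le
        hn0 hn2 ω Ls ψ hLs hψ h1 hω)
  · obtain ⟨ha, hb, hab⟩ := hg1201_patch_slotWeights hσ
    exact neg_convexComb_le_of_neg_le ha hb hab (hcL U' hU') hKQc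

/-- **THE BANKED SLAB `M19b ∩ {U ≥ U_A}` FROM THE «L» AT THE STATION `U_A ∈ [7/2, 44/5]`, corner-objective reads only.** Per density `x ∈ [87/100, 183/200]`:
left-edge family `vL x U′` (`U′ ∈ [U_A, 44/5]`, objective `−X₀(−27/50, U′)`, classes at `(−27/50, U′, x)`) and bottom-AT-`U_A` family `vB x s` (`s ∈ [−27/50, −13/25]`,
objective `−X₀(−27/50, U_A)`, classes at `(s, U_A, x)`), `−v ≤ 0.5166800` ⇒ the M19b cell statement at the bar on the whole slab
`t′ ∈ [−27/50, −43/100] × U ∈ [U_A, 44/5] × n ∈ [167/200, 183/200]` (kinematic cover off the patch: `hg1201M19b_cell_of_cornerPatch`). At `U_A = 7/2` this is the whole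
cell (the leaf via `Hg1201M19b_StiffnessBoxCeiling_of_cellLeaf`); at `U_A = U† > 7/2` it is the banked slab of the captain's zone (ii)(c)/(iii).
[cite: KomaTasaki1994, §1] [cite: ScalapinoWhiteZhang1993, §II] -/
theorem hg1201M19b_slabFromStation_of_L_cornerObjective {UA : ℝ} (hUA : UA ∈ Set.Icc (7 / 2 : ℝ) (44 / 5)) (vL vB : ℝ → ℝ → ℝ)
    (hL : ∀ x ∈ Set.Icc (87 / 100 : ℝ) (183 / 200), ∀ U' ∈ Set.Icc UA (44 / 5),
      ∀ (ω : InfVolFermionState 2) (Ls : ℕ → ℕ) (ψ : ∀ L, Fock (Orb (FermionTorus 2 L))),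
      Tendsto Ls atTop atTop →
      (∀ j, IsGroundStateInSector (hubbardTorusTT' (Ls j) 1 (-27 / 50) U') (rectN x (Ls j)) 0 (ψ (Ls j))) →
      (∀ j, star (ψ (Ls j)) ⬝ᵥ ψ (Ls j) = 1) → ω.IsTorusLimitOf ψ Ls →
      vL x U' ≤ ((Finset.univ : Finset (DihedralGroup 4)).card : ℝ)⁻¹ * ∑ g ∈ (Finset.univ : Finset (DihedralGroup 4)),
        (ω.expect (d4ShiftSet g 0 (box 2 7)) (fermionEmbed (PolySite.d4Emb g 0 (box 2 7)) (-oddMomentObsTT (-27 / 50) U' 0))).re)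
    (hcL : ∀ x ∈ Set.Icc (87 / 100 : ℝ) (183 / 200), ∀ U' ∈ Set.Icc UA (44 / 5), -vL x U' ≤ (5166800 / 10000000 : ℝ))
    (hB : ∀ x ∈ Set.Icc (87 / 100 : ℝ) (183 / 200), ∀ s ∈ Set.Icc (-27 / 50 : ℝ) (-13 / 25),
      ∀ (ω : InfVolFermionState 2) (Ls : ℕ → ℕ) (ψ : ∀ L, Fock (Orb (FermionTorus 2 L))),
      Tendsto Ls atTop atTop →
      (∀ j, IsGroundStateInSector (hubbardTorusTT' (Ls j) 1 s UA) (rectN x (Ls j)) 0 (ψ (Ls j))) →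
      (∀ j, star (ψ (Ls j)) ⬝ᵥ ψ (Ls j) = 1) → ω.IsTorusLimitOf ψ Ls →
      vB x s ≤ ((Finset.univ : Finset (DihedralGroup 4)).card : ℝ)⁻¹ * ∑ g ∈ (Finset.univ : Finset (DihedralGroup 4)),
        (ω.expect (d4ShiftSet g 0 (box 2 7)) (fermionEmbed (PolySite.d4Emb g 0 (box 2 7)) (-oddMomentObsTT (-27 / 50) UA 0))).re)
    (hcB : ∀ x ∈ Set.Icc (87 / 100 : ℝ) (183 / 200), ∀ s ∈ Set.Icc (-27 / 50 : ℝ) (-13 / 25), -vB x s ≤ (5166800 / 10000000 : ℝ)) :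
    ∀ tp ∈ Set.Icc (-27 / 50 : ℝ) (-43 / 100), ∀ U ∈ Set.Icc UA (44 / 5), ∀ n ∈ Set.Icc (167 / 200 : ℝ) (183 / 200),
      ObsStiffnessSeqCeilingAt tp U n (5166800 / 10000000) := by
  have hc : (((5166800 / 10000000 : ℚ)) : ℝ) = (5166800 / 10000000 : ℝ) := by push_cast; norm_num
  refine hg1201M19b_cell_of_cornerPatch (Ulo := UA) (Uhi := 44 / 5) (c := 5166800 / 10000000) le_rfl fun tp htp U hU n hn => ?_
  exact hg1201M19b_slabWord_of_L_cornerObjective hUA (by linarith [hn.1]) hn.2 (vL n) (vB n) (5166800 / 10000000) (by norm_num)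
    (hL n hn) (fun U' hU' => by rw [hc]; exact hcL n hn U' hU') (hB n hn) (fun s hs => by rw [hc]; exact hcB n hn s hs) tp htp U hU

/-- Station bookkeeping (decidable): the captain's candidate stations lie in `[7/2, 44/5]` — `U† ∈ {5, 32/5, 44/5}` — and at `U_A = 7/2` the slab is the whole `U`-range.
[folklore] -/
theorem hg1201M19b_slabFromStation_literals :
    ((7 / 2 : ℚ) ≤ 5 ∧ (5 : ℚ) ≤ 44 / 5) ∧ ((7 / 2 : ℚ) ≤ 32 / 5 ∧ (32 / 5 : ℚ) ≤ 44 / 5) ∧ ((7 / 2 : ℚ) ≤ 44 / 5) := by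
  norm_num

end Summit.Ventures.CertifiedManyBodySolver.Observables

end
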